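import Literature.InformationTheory.Coding.SubspaceWeightsNPComplete
import HarnessLib

/-!
# MINIMUM DISTANCE is in `NP` (the easy half of Vardy 1997, Theorem 5)

Vardy 1997, §IV, proof of Theorem 5: "Clearly, MINIMUM DISTANCE is in NP." This file carries that
out for the tree's language `MINDIST = (encodingF2Matrix ⊗ encodingNatBool).toLanguage minimumDistanceSet`
(`QuantumCodes/MinimumDistanceHardness.lean`; instances `(⟨m, n, H⟩, w)`, "Is there a nonzero
vector `x` of weight `≤ w` such that `H xᵗ = 0`?"), so that the named fact
`Vardy1997_minimumDistance_isNPComplete : IsNPComplete MINDIST` is reduced to its NP-HARDNESS half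
(`isNPComplete_MINDIST_of_isNPHard`). The instance code is the one of SUBSPACE WEIGHTS, so the
instance test `SubspaceWeightsNP.T` and its decoding lemmas (`SubspaceWeightsNPComplete.lean`) are reused.

* `MinDistNP.V` — the verifier on `⟨x, c⟩`: `T x`, and EITHER `m = 0` (no parity check: then a
  weight-one vector works iff `n ≥ 1` and `w ≥ 1`, both read off the numerals) OR `m ≥ 1`, `|c| = n`,
  `c ≠ 0`, `|c| ≤ w` (a sum fold over the `n` witness bits, compared in binary) and every row parity
  `Σ_j H_ij c_j` is `0` (an `allIdxFn` over the rows of sum folds over the columns). The case split is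
  forced by the code: an instance without rows does not bound its numeral `n` by its length, so a
  full-length witness could be exponentially long there.
* `MinDistNP.MINDIST_mem_NP : MINDIST ∈ NP`; `isNPComplete_MINDIST_of_isNPHard`.

## References

* [Vardy1997] A. Vardy, *The intractability of computing the minimum distance of a code*, IEEE
  Trans. Inform. Theory 43 (1997) 1757–1766: §I problem MINIMUM DISTANCE (p. 1757), §IV Theorem 5
  and the first sentence of its proof (p. 1763; held: `lit read doi:10.1109/18.641542`, PDF p. 7
  L158–159 "Proof: Clearly, MINIMUM DISTANCE is in NP.").
* [AroraBarak2009] S. Arora, B. Barak, *Computational Complexity*, CUP 2009, Def. 2.1, §1.3, §0.1.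
-/

noncomputable section

namespace Literature.InformationTheory.Coding

open _root_.Computability Literature.Computability.Complexity Literature.InformationTheory.QuantumCodes
open scoped Literature.Computability.Complexity.Notation

namespace MinDistNP

open Polynomial Brick HashBricks Plumb SubspaceWeightsNP

/-! ### Small facts (twins of the private helpers of `SubspaceWeightsNPComplete.lean`) -/

/-- Parity is the first bit of a numeral. [folklore] -/
private theorem headD_encodeNat (s : ℕ) : (encodeNat s).headD false = decide (s % 2 = 1) := by
  have hv := bitsToNat_encodeNat s
  rcases h : encodeNat s with _ | ⟨b, l⟩
  · rw [h, bitsToNat_nil] at hv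
    subst hv
    rfl
  · rw [h, bitsToNat_cons] at hv
    rw [List.headD_cons, ← hv]
    cases b <;> simp [Nat.add_mul_mod_self_left]

/-- First projections do not lengthen. [folklore] -/
private theorem length_fstF_le (z : List Bool) : (fstF z).length ≤ z.length := by
  have := length_fstF_sndF_le z; omega

/-- A concatenation with at least one piece is at least as long as its first piece. [folklore] -/
private theorem length_first_le_ccat (g : ℕ → List Bool) : ∀ {m : ℕ}, 0 < m → (g 0).length ≤ (ccat g m).length
  | 0, h => absurd h (lt_irrefl 0)
  | 1, _ => by rw [ccat_succ, ccat_zero, List.nil_append]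
  | m + 2, _ => by
    rw [ccat_succ, List.length_append]
    exact (length_first_le_ccat g (Nat.succ_pos m)).trans (Nat.le_add_right _ _)

/-- Value of `mhatF`. [folklore] -/
private theorem mhatF_apply (x : List Bool) : mhatF x = ones (mhat x) := by
  rw [mhatF, Function.comp_apply, fanoutFn_apply, binToUnaryFn_boolPair]; rfl

/-- Value of `nhatF`. [folklore] -/
private theorem nhatF_apply (x : List Bool) : nhatF x = ones (nhat x) := by
  rw [nhatF, Function.comp_apply, fanoutFn_apply, binToUnaryFn_boolPair]; rfl

/-- Value of `itemF`. [folklore] -/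
private theorem itemF_apply (x : List Bool) (t : ℕ) : itemF (boolPair x (ones t)) = item x t := by
  rw [itemF, Function.comp_apply, fanoutFn_apply, sndF_boolPair, Function.comp_apply, fstF_boolPair, nthItemFn_boolPair,
    List.length_replicate]; rfl

/-- The clamps are within the input length. [folklore] -/
private theorem mhat_le (x : List Bool) : mhat x ≤ x.length := Nat.min_le_right _ _

/-- The clamps are within the input length. [folklore] -/
private theorem nhat_le (x : List Bool) : nhat x ≤ x.length := Nat.min_le_right _ _

/-- On a good shape: `mhat = m`, and `nhat = n` as soon as there is a row. [folklore] -/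
private theorem clamps_of_goodShape {x : List Bool} (h : GoodShape x) :
    mhat x = mOf x ∧ (0 < mOf x → nhat x = nOf x) := by
  obtain ⟨hx, hrows⟩ := h
  have hlen := congrArg List.length hx
  simp only [reb, length_boolPair, List.length_replicate] at hlen
  have hm : mhat x = mOf x := by unfold mhat at *; omega
  refine ⟨hm, fun hpos => ?_⟩
  have h0 := hrows 0 (by rw [hm]; exact hpos)
  have hfirst := length_first_le_ccat (fun t => boolPair (item x t) []) (m := mhat x) (by rw [hm]; exact hpos)
  simp only [length_boolPair, List.length_nil] at hfirst
  unfold nhat at *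
  omega

section Code

variable (I : (Σ m : ℕ, Σ n : ℕ, Fin m → Fin n → ZMod 2) × ℕ)

/-- `m ≤ |code|`. [folklore] -/
private theorem m_le_length_encode : I.1.1 ≤ ((encodingF2Matrix.pairBool encodingNatBool).encode I).length := by
  rw [encode_eq]; simp only [length_boolPair, List.length_replicate]; omega

/-- Row codes have length `n`. [folklore] -/
private theorem length_row (i : Fin I.1.1) : ((encodingF2Vec I.1.2.1).encode (I.1.2.2 i)).length = I.1.2.1 := by
  show (List.ofFn _).length = _; rw [List.length_ofFn]

/-- `n ≤ |code|` when there is a row. [folklore] -/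
private theorem n_le_length_encode (hm : 0 < I.1.1) : I.1.2.1 ≤ ((encodingF2Matrix.pairBool encodingNatBool).encode I).length := by
  have hfirst := length_first_le_ccat (fun t => boolPair
    ((List.ofFn fun i : Fin I.1.1 => (encodingF2Vec I.1.2.1).encode (I.1.2.2 i)).getD t []) []) hm
  simp only [length_boolPair, List.length_nil] at hfirst
  rw [List.getD_eq_getElem _ _ (by simpa using hm), List.getElem_ofFn, length_row] at hfirst
  rw [encode_eq]; simp only [length_boolPair, List.length_replicate]; omega

/-- The clamps on a code. [folklore] -/
private theorem clamps_encode :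
    mhat ((encodingF2Matrix.pairBool encodingNatBool).encode I) = I.1.1 ∧
    (0 < I.1.1 → nhat ((encodingF2Matrix.pairBool encodingNatBool).encode I) = I.1.2.1) := by
  refine ⟨?_, fun hm => ?_⟩
  · rw [mhat, (fields_encode I).1, Nat.min_eq_left (m_le_length_encode I)]
  · rw [nhat, (fields_encode I).2.1, Nat.min_eq_left (n_le_length_encode I hm)]

end Code

/-! ### The verifier (bricks) -/

/-- On `⟨u, 1ʲ⟩`, `u = ⟨x, c⟩`: the witness bit `[cⱼ]`. [folklore] -/
def cbitF : List Bool → List Bool := headBitFn ∘ bitAtFn ∘ fanoutFn sndF (sndF ∘ fstF)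
/-- On `u`: the fold record `⟨u, ⟨bin nhat, ⟨1⁰, bin 0⟩⟩⟩` (the witness is indexed by COLUMNS). [folklore] -/
def initW : List Bool → List Bool := fanoutFn id (fanoutFn (lenBinF ∘ nhatF ∘ fstF) (fun _ => boolPair [] []))
/-- On `u`: the numeral of the weight of `c`. [cite: AroraBarak2009, §1.3 (bounded loops)] -/
def sumW : List Bool → List Bool := sndPow 2 ∘ foldLoop addFn cbitF X ∘ initW
/-- On `u`: `[m = 0]`. [folklore] -/
def M0 : List Bool → List Bool := eqPairFn ∘ fanoutFn (mhatF ∘ fstF) (fun _ => [])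
/-- On `u`: `[1 ≤ n]`. [folklore] -/
def N1 : List Bool → List Bool := ltFn ∘ fanoutFn (fun _ => []) (nnF ∘ fstF)
/-- On `u`: `[1 ≤ w]`. [folklore] -/
def Wpos : List Bool → List Bool := ltFn ∘ fanoutFn (fun _ => []) (sndF ∘ fstF)
/-- On `u`: `[|c| = nhat]`. [folklore] -/
def L1 : List Bool → List Bool := eqPairFn ∘ fanoutFn (onesFn ∘ sndF) (nhatF ∘ fstF)
/-- On `u`: `[c ≠ 0]` (positive weight). [cite: Vardy1997, §I (p. 1757: "a nonzero vector")] -/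
def NZ : List Bool → List Bool := ltFn ∘ fanoutFn (fun _ => []) sumW
/-- On `u`: `[weight ≤ w]`. [cite: Vardy1997, §I (p. 1757: "of weight ≤ w")] -/
def WT : List Bool → List Bool := notFn (ltFn ∘ fanoutFn (sndF ∘ fstF) sumW)
/-- On `⟨⟨u, 1ⁱ⟩, 1ʲ⟩`: `[cⱼ ∧ H_ij]`. [folklore] -/
def pbitF : List Bool → List Bool :=
  andFn (headBitFn ∘ bitAtFn ∘ fanoutFn sndF (sndF ∘ fstF ∘ fstF))
    (headBitFn ∘ bitAtFn ∘ fanoutFn sndF (itemF ∘ fanoutFn (fstF ∘ fstF ∘ fstF) (sndF ∘ fstF)))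
/-- On `r = ⟨u, 1ⁱ⟩`: the fold record `⟨r, ⟨bin nhat, ⟨1⁰, bin 0⟩⟩⟩`. [folklore] -/
def initR : List Bool → List Bool := fanoutFn id (fanoutFn (lenBinF ∘ nhatF ∘ fstF ∘ fstF) (fun _ => boolPair [] []))
/-- On `r`: the numeral of the row sum `Σ_j H_ij c_j`. [cite: AroraBarak2009, §1.3 (bounded loops)] -/
def sumR : List Bool → List Bool := sndPow 2 ∘ foldLoop addFn pbitF X ∘ initR
/-- On `r`: `[the row sum is even]`. [cite: Vardy1997, §I (p. 1757: "H xᵗ = 0")] -/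
def rowC : List Bool → List Bool := notFn (headBitFn ∘ sumR)
/-- On `u`: all parity checks hold. [cite: Vardy1997, §I (p. 1757)] -/
def PAR : List Bool → List Bool := allIdxFn (mhatF ∘ fstF) rowC
/-- On `u`: the two cases (no rows / rows). [cite: Vardy1997, §IV Theorem 5 (proof: "MINIMUM DISTANCE is in NP")] -/
def CASE : List Bool → List Bool :=
  orFn (andFn M0 (andFn N1 Wpos)) (andFn (notFn M0) (andFn L1 (andFn NZ (andFn WT PAR))))
/-- **The verifier** `V = T ∧ CASE` on `u = ⟨x, c⟩`. [cite: Vardy1997, §IV Theorem 5 (proof: "Clearly, MINIMUM DISTANCE is in NP")] -/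
def V : List Bool → List Bool := andFn (T ∘ fstF) CASE

/-- One-bit functions have linear growth. [folklore] -/
private theorem length_le_of_oneBit {f : List Bool → List Bool} (hf : OneBit f) (z : List Bool) :
    (f z).length ≤ 1 * ((fstF z).length + 1) := by
  rw [hf.length_eq]; omega

/-- `sumW ∈ FP`. [cite: AroraBarak2009, §1.3 (polynomial time is closed under composition and bounded loops)] -/
theorem sumW_mem_FP : sumW ∈ FP :=
  comp_mem_FP (sndPow_mem_FP 2) (comp_mem_FP
    (foldLoop_mem_FP addFn_mem_FP length_addFn_le
      (comp_mem_FP headBitFn_mem_FP (comp_mem_FP bitAtFn_mem_FP (fanoutFn_mem_FP sndF_mem_FP (comp_mem_FP sndF_mem_FP fstF_mem_FP))))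
      (length_le_of_oneBit (oneBit_headBitFn.comp _)) X)
    (fanoutFn_mem_FP OracleCompose.id_mem_FP (fanoutFn_mem_FP
      (comp_mem_FP lenBinF_mem_FP (comp_mem_FP nhatF_mem_FP fstF_mem_FP)) (const_mem_FP _))))

/-- `pbitF ∈ FP`. [cite: AroraBarak2009, §1.3 (polynomial time is closed under composition)] -/
theorem pbitF_mem_FP : pbitF ∈ FP :=
  andFn_mem_FP (comp_mem_FP headBitFn_mem_FP (comp_mem_FP bitAtFn_mem_FP (fanoutFn_mem_FP sndF_mem_FP
    (comp_mem_FP sndF_mem_FP (comp_mem_FP fstF_mem_FP fstF_mem_FP)))))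
    (comp_mem_FP headBitFn_mem_FP (comp_mem_FP bitAtFn_mem_FP (fanoutFn_mem_FP sndF_mem_FP
      (comp_mem_FP itemF_mem_FP (fanoutFn_mem_FP (comp_mem_FP fstF_mem_FP (comp_mem_FP fstF_mem_FP fstF_mem_FP))
        (comp_mem_FP sndF_mem_FP fstF_mem_FP))))))

/-- `pbitF` is one-bit. [cite: AroraBarak2009, §1.3 (polynomial time is closed under composition)] -/
theorem oneBit_pbitF : OneBit pbitF := oneBit_andFn (oneBit_headBitFn.comp _) (oneBit_headBitFn.comp _)

/-- `sumR ∈ FP`. [cite: AroraBarak2009, §1.3 (polynomial time is closed under composition and bounded loops)] -/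
theorem sumR_mem_FP : sumR ∈ FP :=
  comp_mem_FP (sndPow_mem_FP 2) (comp_mem_FP
    (foldLoop_mem_FP addFn_mem_FP length_addFn_le pbitF_mem_FP (length_le_of_oneBit oneBit_pbitF) X)
    (fanoutFn_mem_FP OracleCompose.id_mem_FP (fanoutFn_mem_FP
      (comp_mem_FP lenBinF_mem_FP (comp_mem_FP nhatF_mem_FP (comp_mem_FP fstF_mem_FP fstF_mem_FP))) (const_mem_FP _))))

/-- `rowC` is one-bit. [cite: AroraBarak2009, §1.3 (polynomial time is closed under composition)] -/
theorem oneBit_rowC : OneBit rowC := oneBit_notFn (oneBit_headBitFn.comp _)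

/-- `PAR ∈ FP`. [cite: AroraBarak2009, §1.3 (polynomial time is closed under composition and bounded loops)] -/
theorem PAR_mem_FP : PAR ∈ FP :=
  allIdxFn_mem_FP (comp_mem_FP mhatF_mem_FP fstF_mem_FP) (notFn_mem_FP (comp_mem_FP headBitFn_mem_FP sumR_mem_FP)) oneBit_rowC

/-- `PAR` is one-bit. [cite: AroraBarak2009, §1.3 (polynomial time is closed under composition)] -/
theorem oneBit_PAR : OneBit PAR :=
  oneBit_allIdxFn oneBit_rowC fun u => by
    rw [Function.comp_apply, mhatF_apply, List.length_replicate]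
    exact (mhat_le _).trans (length_fstF_le u)

/-- `CASE ∈ FP`. [cite: AroraBarak2009, §1.3 (polynomial time is closed under composition and bounded loops)] -/
theorem CASE_mem_FP : CASE ∈ FP := by
  have hM0 : M0 ∈ FP := comp_mem_FP eqPairFn_mem_FP (fanoutFn_mem_FP (comp_mem_FP mhatF_mem_FP fstF_mem_FP) (const_mem_FP _))
  have hnn : nnF ∈ FP := comp_mem_FP fstF_mem_FP (comp_mem_FP sndF_mem_FP fstF_mem_FP)
  have hN1 : N1 ∈ FP := comp_mem_FP ltFn_mem_FP (fanoutFn_mem_FP (const_mem_FP _) (comp_mem_FP hnn fstF_mem_FP))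
  have hW : Wpos ∈ FP := comp_mem_FP ltFn_mem_FP (fanoutFn_mem_FP (const_mem_FP _) (comp_mem_FP sndF_mem_FP fstF_mem_FP))
  have hL : L1 ∈ FP := comp_mem_FP eqPairFn_mem_FP (fanoutFn_mem_FP (comp_mem_FP onesFn_mem_FP sndF_mem_FP)
    (comp_mem_FP nhatF_mem_FP fstF_mem_FP))
  have hNZ : NZ ∈ FP := comp_mem_FP ltFn_mem_FP (fanoutFn_mem_FP (const_mem_FP _) sumW_mem_FP)
  have hWT : WT ∈ FP := notFn_mem_FP (comp_mem_FP ltFn_mem_FP (fanoutFn_mem_FP (comp_mem_FP sndF_mem_FP fstF_mem_FP) sumW_mem_FP))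
  exact orFn_mem_FP (andFn_mem_FP hM0 (andFn_mem_FP hN1 hW))
    (andFn_mem_FP (notFn_mem_FP hM0) (andFn_mem_FP hL (andFn_mem_FP hNZ (andFn_mem_FP hWT PAR_mem_FP))))

/-- `CASE` is one-bit. [cite: AroraBarak2009, §1.3 (polynomial time is closed under composition)] -/
theorem oneBit_CASE : OneBit CASE :=
  oneBit_orFn (oneBit_andFn (oneBit_eqPairFn.comp _) (oneBit_andFn (oneBit_ltFn.comp _) (oneBit_ltFn.comp _)))
    (oneBit_andFn (oneBit_notFn (oneBit_eqPairFn.comp _)) (oneBit_andFn (oneBit_eqPairFn.comp _)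
      (oneBit_andFn (oneBit_ltFn.comp _) (oneBit_andFn (oneBit_notFn (oneBit_ltFn.comp _)) oneBit_PAR))))

/-- **`V ∈ FP`.** [cite: AroraBarak2009, §1.3 (polynomial time is closed under composition and bounded loops)] -/
theorem V_mem_FP : V ∈ FP := andFn_mem_FP (comp_mem_FP T_mem_FP fstF_mem_FP) CASE_mem_FP

/-- **`V` is one-bit.** [cite: AroraBarak2009, §1.3 (polynomial time is closed under composition)] -/
theorem oneBit_V : OneBit V := oneBit_andFn (oneBit_T.comp _) oneBit_CASE

/-! ### Values -/

/-- Number of ones among the first `k` bits of `c` (as in `SubspaceWeightsNP.wt`). [folklore] -/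
private theorem wt_def (c : List Bool) (k : ℕ) : wt c k = ∑ i ∈ Finset.range k, (c.getD i false).toNat := rfl

/-- The row sum `Σ_{j<k} c_j H_ij` over `ℕ`. [cite: Vardy1997, §I (p. 1757)] -/
def rowSum (x c : List Bool) (i k : ℕ) : ℕ := ∑ j ∈ Finset.range k, (c.getD j false && (item x i).getD j false).toNat

/-- A single bit as a numeral. [folklore] -/
private theorem bitsToNat_single (b : Bool) : bitsToNat [b] = b.toNat := by
  rw [bitsToNat_cons, bitsToNat_nil]; omega

/-- Value of `cbitF`. [folklore] -/
private theorem cbitF_apply (x c : List Bool) (j : ℕ) : cbitF (boolPair (boolPair x c) (ones j)) = [c.getD j false] := by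
  simp only [cbitF, Function.comp_apply, fanoutFn_apply, sndF_boolPair, fstF_boolPair, bitAtFn_boolPair,
    List.length_replicate, headBitFn_apply, ThreeDMNP.headD_take_drop]

/-- Value of `sumW`. [folklore] -/
private theorem sumW_apply (x c : List Bool) : sumW (boolPair x c) = encodeNat (wt c (nhat x)) := by
  have hinit : initW (boolPair x c) =
      boolPair (boolPair x c) (boolPair (encodeNat (nhat x)) (boolPair (ones 0) (encodeNat 0))) := by
    simp only [initW, fanoutFn_apply, id, Function.comp_apply, fstF_boolPair, nhatF_apply, lenBinF_apply,
      List.length_replicate]; rfl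
  have hk : nhat x ≤ (X : Polynomial ℕ).eval (boolPair x c).length := by
    rw [eval_X, length_boolPair]; have := nhat_le x; omega
  rw [sumW, Function.comp_apply, Function.comp_apply, hinit, foldLoop_apply addFn cbitF hk 0 (encodeNat 0), foldAcc_addFn]
  simp only [sndPow, Function.comp_apply, sndF_boolPair, Nat.zero_add, cbitF_apply, bitsToNat_single, wt_def]

/-- Value of `pbitF`. [folklore] -/
private theorem pbitF_apply (x c : List Bool) (i j : ℕ) :
    pbitF (boolPair (boolPair (boolPair x c) (ones i)) (ones j)) = [c.getD j false && (item x i).getD j false] := by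
  have h1 : (headBitFn ∘ bitAtFn ∘ fanoutFn sndF (sndF ∘ fstF ∘ fstF)) (boolPair (boolPair (boolPair x c) (ones i)) (ones j)) =
      [c.getD j false] := by
    simp only [Function.comp_apply, fanoutFn_apply, sndF_boolPair, fstF_boolPair, bitAtFn_boolPair, List.length_replicate,
      headBitFn_apply, ThreeDMNP.headD_take_drop]
  have h2 : (headBitFn ∘ bitAtFn ∘ fanoutFn sndF (itemF ∘ fanoutFn (fstF ∘ fstF ∘ fstF) (sndF ∘ fstF)))
      (boolPair (boolPair (boolPair x c) (ones i)) (ones j)) = [(item x i).getD j false] := by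
    simp only [Function.comp_apply, fanoutFn_apply, sndF_boolPair, fstF_boolPair, itemF_apply, bitAtFn_boolPair,
      List.length_replicate, headBitFn_apply, ThreeDMNP.headD_take_drop]
  rw [pbitF, andFn_apply h1 h2]

/-- Value of `sumR`. [folklore] -/
private theorem sumR_apply (x c : List Bool) (i : ℕ) :
    sumR (boolPair (boolPair x c) (ones i)) = encodeNat (rowSum x c i (nhat x)) := by
  have hinit : initR (boolPair (boolPair x c) (ones i)) =
      boolPair (boolPair (boolPair x c) (ones i)) (boolPair (encodeNat (nhat x)) (boolPair (ones 0) (encodeNat 0))) := by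
    simp only [initR, fanoutFn_apply, id, Function.comp_apply, fstF_boolPair, nhatF_apply, lenBinF_apply,
      List.length_replicate]; rfl
  have hk : nhat x ≤ (X : Polynomial ℕ).eval (boolPair (boolPair x c) (ones i)).length := by
    rw [eval_X, length_boolPair, length_boolPair]; have := nhat_le x; omega
  rw [sumR, Function.comp_apply, Function.comp_apply, hinit, foldLoop_apply addFn pbitF hk 0 (encodeNat 0), foldAcc_addFn]
  simp only [sndPow, Function.comp_apply, sndF_boolPair, Nat.zero_add, pbitF_apply, bitsToNat_single, rowSum]

/-- Value of `PAR`. [folklore] -/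
private theorem PAR_apply (x c : List Bool) :
    PAR (boolPair x c) = [decide (∀ i < mhat x, ¬ rowSum x c i (nhat x) % 2 = 1)] := by
  have hr : ∀ i, rowC (boolPair (boolPair x c) (ones i)) = [!decide (rowSum x c i (nhat x) % 2 = 1)] := fun i => by
    rw [rowC, notFn_apply]
    rw [Function.comp_apply, sumR_apply, headBitFn_apply, headD_encodeNat]
  rw [PAR, allIdxFn_apply oneBit_rowC (h := mhatF ∘ fstF)
    (by rw [Function.comp_apply, fstF_boolPair, mhatF_apply, List.length_replicate, length_boolPair]; have := mhat_le x; omega),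
    Function.comp_apply, fstF_boolPair, mhatF_apply, List.length_replicate]
  simp [hr]

/-- Value of `CASE`. [folklore] -/
private theorem CASE_apply (x c : List Bool) :
    CASE (boolPair x c) = [decide (mhat x = 0) && (decide (0 < nOf x) && decide (0 < wOf x)) ||
      !decide (mhat x = 0) && (decide (c.length = nhat x) && (decide (0 < wt c (nhat x)) &&
        (!decide (wOf x < wt c (nhat x)) && decide (∀ i < mhat x, ¬ rowSum x c i (nhat x) % 2 = 1))))] := by
  have hM0 : M0 (boolPair x c) = [decide (mhat x = 0)] := by
    rw [M0, Function.comp_apply, fanoutFn_apply, Function.comp_apply, fstF_boolPair, mhatF_apply, eqPairFn_boolPair]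
    cases h : mhat x <;> simp [ones]
  have hN1 : N1 (boolPair x c) = [decide (0 < nOf x)] := by
    rw [N1, Function.comp_apply, fanoutFn_apply, Function.comp_apply, fstF_boolPair, ltFn_boolPair, bitsToNat_nil]; rfl
  have hW : Wpos (boolPair x c) = [decide (0 < wOf x)] := by
    rw [Wpos, Function.comp_apply, fanoutFn_apply, Function.comp_apply, fstF_boolPair, ltFn_boolPair, bitsToNat_nil]; rfl
  have hL : L1 (boolPair x c) = [decide (c.length = nhat x)] := by
    rw [L1, Function.comp_apply, fanoutFn_apply, Function.comp_apply, sndF_boolPair, ThreeDMNP.onesFn_eq_ones,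
      Function.comp_apply, fstF_boolPair, nhatF_apply, eqPairFn_boolPair]
    simp
  have hNZ : NZ (boolPair x c) = [decide (0 < wt c (nhat x))] := by
    rw [NZ, Function.comp_apply, fanoutFn_apply, sumW_apply, ltFn_boolPair, bitsToNat_nil, bitsToNat_encodeNat]
  have hWT : WT (boolPair x c) = [!decide (wOf x < wt c (nhat x))] := by
    rw [WT, notFn_apply]
    rw [Function.comp_apply, fanoutFn_apply, Function.comp_apply, fstF_boolPair, sumW_apply, ltFn_boolPair,
      bitsToNat_encodeNat]; rfl
  rw [CASE, orFn_apply (andFn_apply hM0 (andFn_apply hN1 hW))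
    (andFn_apply (notFn_apply hM0) (andFn_apply hL (andFn_apply hNZ (andFn_apply hWT (PAR_apply x c)))))]

/-- **Value of the verifier.** [cite: Vardy1997, §IV Theorem 5 (proof)] -/
theorem V_eq_true_iff (x c : List Bool) :
    V (boolPair x c) = [true] ↔ GoodShape x ∧
      ((mhat x = 0 ∧ 0 < nOf x ∧ 0 < wOf x) ∨
       (mhat x ≠ 0 ∧ c.length = nhat x ∧ 0 < wt c (nhat x) ∧ wt c (nhat x) ≤ wOf x ∧
          ∀ i < mhat x, ¬ rowSum x c i (nhat x) % 2 = 1)) := by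
  rw [V, andFn_eq_true_iff (oneBit_T.comp fstF) oneBit_CASE, Function.comp_apply, fstF_boolPair, T_eq_true_iff, CASE_apply]
  simp only [List.cons.injEq, and_true, Bool.or_eq_true, Bool.and_eq_true, Bool.not_eq_true', decide_eq_true_eq,
    decide_eq_false_iff_not, not_lt]

/-! ### The verifier's language -/

/-- The verifier's language. [cite: Vardy1997, §IV Theorem 5 (proof)] -/
def Rlang : Language Bool := {u | V u = [true]}

/-- **`Rlang ∈ P`.** [cite: AroraBarak2009, Def. 1.13] -/
theorem Rlang_mem_P : Rlang ∈ Classes.P :=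
  mem_P_of_mem_FP V_mem_FP _ fun u =>
    ⟨fun h => h, fun h => by
      obtain ⟨b, hb⟩ := oneBit_V u
      cases b
      · exact hb
      · exact absurd hb h⟩

/-! ### Soundness and completeness -/

/-- `Bool.toNat` as an indicator. [folklore] -/
private theorem toNat_eq_ite (b : Bool) : b.toNat = if b = true then 1 else 0 := by cases b <;> rfl

/-- Even residues are zero in `𝔽₂`. [folklore] -/
private theorem natCast_eq_zero_iff (S : ℕ) : (S : ZMod 2) = 0 ↔ ¬ S % 2 = 1 := by
  rw [← ZMod.natCast_mod S 2]
  have h := Nat.mod_lt S two_pos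
  interval_cases hS : S % 2 <;> simp

/-- A range sum of bit indicators is the number of set positions. [folklore] -/
private theorem sum_range_toNat_eq_card (k : ℕ) (P : ℕ → Bool) :
    ∑ i ∈ Finset.range k, (P i).toNat = ((Finset.univ : Finset (Fin k)).filter fun i : Fin k => P (i : ℕ) = true).card := by
  rw [← Fin.sum_univ_eq_sum_range (fun i => (P i).toNat) k, Finset.card_filter]
  exact Finset.sum_congr rfl fun i _ => toNat_eq_ite _

/-- **The semantic content of the witness checks** (columns version): for `c` of length `n`, the
vector `x_j = [c_j]` has weight `wt c n`, is nonzero iff that weight is positive, and `(H x)_i` is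
the parity of the row sum. [cite: Vardy1997, §I (p. 1757)] -/
theorem checks_iff {m n : ℕ} (A : Fin m → Fin n → ZMod 2) (w : ℕ)
    (rows : ℕ → List Bool) (hrows : ∀ (i : Fin m) (j : Fin n), A i j = if (rows i).getD j false = true then 1 else 0)
    (c : List Bool) :
    ((fun j : Fin n => if c.getD j false = true then (1 : ZMod 2) else 0) ≠ 0 ∧
      hammingNorm (fun j : Fin n => if c.getD j false = true then (1 : ZMod 2) else 0) ≤ w ∧
      (Matrix.of A).mulVec (fun j : Fin n => if c.getD j false = true then (1 : ZMod 2) else 0) = 0) ↔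
    (0 < ∑ j ∈ Finset.range n, (c.getD j false).toNat ∧ ∑ j ∈ Finset.range n, (c.getD j false).toNat ≤ w ∧
      ∀ i < m, ¬ (∑ j ∈ Finset.range n, (c.getD j false && (rows i).getD j false).toNat) % 2 = 1) := by
  have hw : hammingNorm (fun j : Fin n => if c.getD j false = true then (1 : ZMod 2) else 0) =
      ∑ j ∈ Finset.range n, (c.getD j false).toNat := by
    rw [sum_range_toNat_eq_card]
    unfold hammingNorm
    exact congrArg Finset.card (Finset.filter_congr fun j _ => by
      dsimp only
      cases h : c.getD (j : ℕ) false <;> simp)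
  have hrow : ∀ i : Fin m, (Matrix.of A).mulVec (fun j : Fin n => if c.getD j false = true then (1 : ZMod 2) else 0) i =
      ((∑ j ∈ Finset.range n, (c.getD j false && (rows i).getD j false).toNat : ℕ) : ZMod 2) := by
    intro i
    rw [sum_range_toNat_eq_card, Finset.natCast_card_filter, Matrix.mulVec, dotProduct]
    refine Finset.sum_congr rfl fun j _ => ?_
    dsimp only [Matrix.of_apply]
    rw [hrows i j]
    cases h1 : c.getD (j : ℕ) false <;> cases h2 : (rows (i : ℕ)).getD (j : ℕ) false <;> simp
  have hnz : ((fun j : Fin n => if c.getD j false = true then (1 : ZMod 2) else 0) ≠ 0) ↔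
      0 < ∑ j ∈ Finset.range n, (c.getD j false).toNat := by
    rw [← hw, pos_iff_ne_zero]
    exact not_congr hammingNorm_eq_zero.symm
  rw [hw, hnz]
  refine and_congr Iff.rfl (and_congr Iff.rfl ⟨fun h i hi => ?_, fun h => funext fun i => ?_⟩)
  · have := congr_fun h ⟨i, hi⟩
    rw [hrow, Pi.zero_apply] at this
    exact (natCast_eq_zero_iff _).1 this
  · rw [hrow, Pi.zero_apply]
    exact (natCast_eq_zero_iff _).2 (h i i.2)

/-- **Soundness**: an accepted pair codes a YES instance. [cite: Vardy1997, §IV Theorem 5 (proof)] -/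
theorem mem_of_accepts {x c : List Bool} (h : V (boolPair x c) = [true]) : x ∈ MINDIST := by
  obtain ⟨hshape, hcase⟩ := (V_eq_true_iff x c).1 h
  obtain ⟨hm, hn⟩ := clamps_of_goodShape hshape
  rw [← encode_instOf hshape, MINDIST, Computability.Encoding.mem_toLanguage_iff]
  show ∃ y : Fin (nOf x) → ZMod 2, y ≠ 0 ∧ hammingNorm y ≤ wOf x ∧ (Matrix.of (AOf x)).mulVec y = 0
  rcases hcase with ⟨h0, hn1, hw1⟩ | ⟨h0, hlen, hpos, hle, hpar⟩
  · -- no rows: a unit vector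
    have hm0 : mOf x = 0 := by rw [← hm, h0]
    refine ⟨fun j => if (j : ℕ) = 0 then 1 else 0, ?_, ?_, ?_⟩
    · intro hzero
      have := congr_fun hzero ⟨0, hn1⟩
      simp at this
    · have hval : ∀ a : Fin (nOf x), (fun j : Fin (nOf x) => if (j : ℕ) = 0 then (1 : ZMod 2) else 0) a ≠ 0 → (a : ℕ) = 0 :=
        fun a ha => by by_contra hne; exact ha (if_neg hne)
      have hwt : hammingNorm (fun j : Fin (nOf x) => if (j : ℕ) = 0 then (1 : ZMod 2) else 0) ≤ 1 := by
        unfold hammingNorm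
        exact Finset.card_le_one.2 fun a ha b hb =>
          Fin.ext ((hval a (Finset.mem_filter.1 ha).2).trans (hval b (Finset.mem_filter.1 hb).2).symm)
      exact hwt.trans (Nat.one_le_iff_ne_zero.2 (Nat.pos_iff_ne_zero.1 hw1))
    · funext i
      exact absurd (lt_of_lt_of_eq i.2 hm0) (Nat.not_lt_zero _)
  · rw [hm] at h0 hpar
    have hmpos : 0 < mOf x := Nat.pos_of_ne_zero h0
    rw [hn hmpos] at hlen hpos hle hpar
    refine ⟨fun j => if c.getD j false = true then 1 else 0, ?_⟩
    exact (checks_iff (AOf x) (wOf x) (item x) (fun i j => rfl) c).2 ⟨hpos, hle, hpar⟩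

/-- Every element of `𝔽₂` is the indicator of being `1`. [folklore] -/
private theorem zmod2_eq_ite (a : ZMod 2) : a = if decide (a = 1) = true then 1 else 0 := by
  revert a; decide

/-- **Completeness**: a YES instance has a short accepted witness (the bits of `x`, or nothing when
there is no row). [cite: Vardy1997, §IV Theorem 5 (proof)] -/
theorem accepts_of_mem (I : (Σ m : ℕ, Σ n : ℕ, Fin m → Fin n → ZMod 2) × ℕ) (hI : I ∈ minimumDistanceSet) :
    ∃ c : List Bool, c.length ≤ ((encodingF2Matrix.pairBool encodingNatBool).encode I).length ∧
      V (boolPair ((encodingF2Matrix.pairBool encodingNatBool).encode I) c) = [true] := by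
  obtain ⟨⟨m, n, A⟩, w⟩ := I
  obtain ⟨xv, hx0, hxw, hxA⟩ := hI
  obtain ⟨hm, hn⟩ := clamps_encode (⟨m, n, A⟩, w)
  obtain ⟨-, h2, h3, -⟩ := fields_encode (⟨m, n, A⟩, w)
  rcases Nat.eq_zero_or_pos m with hm0 | hmpos
  · -- no rows: the instance is YES iff `n ≥ 1` and `w ≥ 1`, which the verifier reads off the numerals
    subst hm0
    refine ⟨[], by simp, ?_⟩
    rw [V_eq_true_iff, hm, h2, h3]
    refine ⟨goodShape_encode _, Or.inl ⟨rfl, ?_, ?_⟩⟩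
    · rcases Nat.eq_zero_or_pos n with hn0 | hnpos
      · subst hn0
        exact absurd (funext fun j => Fin.elim0 j) hx0
      · exact hnpos
    · have h1 : 1 ≤ hammingNorm xv := Nat.one_le_iff_ne_zero.2 (mt hammingNorm_eq_zero.1 hx0)
      exact lt_of_lt_of_le Nat.zero_lt_one (h1.trans hxw)
  · have hclen : (List.ofFn fun j : Fin n => decide (xv j = 1)).length = n := List.length_ofFn
    have hcx : (fun j : Fin n => if (List.ofFn fun j : Fin n => decide (xv j = 1)).getD j false = true then (1 : ZMod 2) else 0) = xv := by
      funext j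
      rw [List.getD_eq_getElem _ _ (by simp), List.getElem_ofFn]
      exact (zmod2_eq_ite (xv j)).symm
    refine ⟨List.ofFn fun j : Fin n => decide (xv j = 1), ?_, ?_⟩
    · rw [hclen]; exact n_le_length_encode (⟨m, n, A⟩, w) hmpos
    · rw [V_eq_true_iff, hm, hn hmpos, h3]
      have key := (checks_iff A w (item ((encodingF2Matrix.pairBool encodingNatBool).encode (⟨m, n, A⟩, w)))
        (fun i j => ?_) _).1 (by rw [hcx]; exact ⟨hx0, hxw, hxA⟩)
      · exact ⟨goodShape_encode _, Or.inr ⟨Nat.pos_iff_ne_zero.1 hmpos, hclen, key⟩⟩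
      · have hi : (List.ofFn fun i : Fin m => (encodingF2Vec n).encode (A i)).getD i [] = (encodingF2Vec n).encode (A i) := by
          rw [List.getD_eq_getElem _ _ (by simp), List.getElem_ofFn]
        rw [item_encode, hi]
        show A i j = if (List.ofFn fun j : Fin n => decide (A i j = 1)).getD j false = true then 1 else 0
        rw [List.getD_eq_getElem _ _ (by simp), List.getElem_ofFn]
        exact zmod2_eq_ite _

/-- **MINIMUM DISTANCE is in `NP`** ("Clearly, MINIMUM DISTANCE is in NP": guess the nonzero vector
`x`, check its weight and `H xᵗ = 0`). [cite: Vardy1997, §IV Theorem 5 (proof, first sentence, p. 1763)] -/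
theorem MINDIST_mem_NP : MINDIST ∈ Nondeterministic.NP := by
  refine ⟨Rlang, Rlang_mem_P, X, fun x => ⟨?_, ?_⟩⟩
  · rintro ⟨I, hI, rfl⟩
    obtain ⟨c, hc, hV⟩ := accepts_of_mem I hI
    exact ⟨c, by rw [eval_X]; exact hc, hV⟩
  · rintro ⟨c, -, hc⟩
    exact mem_of_accepts hc

end MinDistNP

/-- **Vardy's Theorem 5 reduced to its hardness half**: since `MINDIST ∈ NP` is proved
(`MinDistNP.MINDIST_mem_NP`), the named fact `Vardy1997_minimumDistance_isNPComplete` follows from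
`IsNPHard MINDIST` alone. [cite: Vardy1997, §IV Theorem 5 (p. 1763)] -/
theorem isNPComplete_MINDIST_of_isNPHard (h : IsNPHard MINDIST) : Vardy1997_minimumDistance_isNPComplete :=
  ⟨MinDistNP.MINDIST_mem_NP, h⟩

end Literature.InformationTheory.Coding

end
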